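import Summits.Ventures.CertifiedManyBodySolver.Downfold.EmeryZoneOrbitalContentShell
import HarnessLib

/-!
# THE ORBITAL PARTITION OF THE HOLES OVER THE ZONE, IIIb: per coarse cell — harmonic range, shell index range, clipped weights

Venture CertifiedManyBodySolver, cell `pub/hubbard-downfold` (stage S1; INFLATION-RULES-3to1-B §B.81), seat hubbard-downfold-mod-4
(technique B, g33); namespace `Summit.Ventures.CertifiedManyBodySolver.Downfold.Emery`. Everything PROVED (0 sorry). WHAT THIS IS NOT: a
statement about any material; `U = 0` one-body kinematics of the σ model.

* the harmonic `s = x + y − 2xy` of a box lies between its corner values (`tpHarm_mem_corners`); the integer harmonic range of a coarse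
  cell from the four table corners (`cornerZ`, `sRangeZ`, **`sRangeZ_sound`**: `0 ≤ Sa`, `Sa/10⁹ ≤ s(k) ≤ Sb/10⁹`, `Sb ≤ 10⁹`);
* the shell index range of a coarse cell from its row's outer / inner threshold lists (`mloOf`, `mhiOf`, specifications);
* the clipped cell weights `cellWlo = min W (max 0 (min_m wLoZ))`, `cellWhi = max 0 (min W (max_m wHiZ))` over a shell segment and
  their sandwich / range lemmas (`cellWlo_spec`, `cellWhi_spec`, `cellWlo_mem`, `cellWhi_mem`).

Sources: [HybertsenSchluterChristensen1989, Eq. (1)]; [AndersenEtAl1995, §6]; interval arithmetic [folklore] (Moore 1966).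
-/

namespace Summit.Ventures.CertifiedManyBodySolver.Downfold.Emery

open Real Set

/-! ## §5 Per coarse cell: the harmonic range, the shell index range, the clipped weight enclosure -/

/-- An affine function lies between its endpoint values. [folklore] -/
theorem affine_mem_endpoints (p q : ℝ) {t t0 t1 : ℝ} (h0 : t0 ≤ t) (h1 : t ≤ t1) :
    min (p + q * t0) (p + q * t1) ≤ p + q * t ∧ p + q * t ≤ max (p + q * t0) (p + q * t1) := by
  rcases le_or_gt 0 q with hq | hq
  · exact ⟨(min_le_left _ _).trans (by nlinarith), le_trans (by nlinarith) (le_max_right _ _)⟩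
  · exact ⟨(min_le_right _ _).trans (by nlinarith), le_trans (by nlinarith) (le_max_left _ _)⟩

/-- **The harmonic `s = x + y − 2xy` of a box lies between its four corner values.** [folklore] -/
theorem tpHarm_mem_corners {x y x0 x1 y0 y1 : ℝ} (hx0 : x0 ≤ x) (hx1 : x ≤ x1) (hy0 : y0 ≤ y) (hy1 : y ≤ y1) :
    min (min (tpHarm x0 y0) (tpHarm x0 y1)) (min (tpHarm x1 y0) (tpHarm x1 y1)) ≤ tpHarm x y ∧
    tpHarm x y ≤ max (max (tpHarm x0 y0) (tpHarm x0 y1)) (max (tpHarm x1 y0) (tpHarm x1 y1)) := by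
  have ex : ∀ u v : ℝ, tpHarm u v = v + (1 - 2 * v) * u := fun u v => by unfold tpHarm; ring
  have ey : ∀ u v : ℝ, tpHarm u v = u + (1 - 2 * u) * v := fun u v => by unfold tpHarm; ring
  -- in x at fixed y
  have hx := affine_mem_endpoints y (1 - 2 * y) hx0 hx1
  rw [← ex x y, ← ex x0 y, ← ex x1 y] at hx
  -- in y at the two x-ends
  have h0 := affine_mem_endpoints x0 (1 - 2 * x0) hy0 hy1
  rw [← ey x0 y, ← ey x0 y0, ← ey x0 y1] at h0
  have h1' := affine_mem_endpoints x1 (1 - 2 * x1) hy0 hy1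
  rw [← ey x1 y, ← ey x1 y0, ← ey x1 y1] at h1'
  constructor
  · refine le_trans ?_ hx.1
    exact le_min ((min_le_left _ _).trans h0.1) ((min_le_right _ _).trans h1'.1)
  · refine hx.2.trans ?_
    exact max_le (h0.2.trans (le_max_left _ _)) (h1'.2.trans (le_max_right _ _))


/-- `10¹⁸·tpHarm(X/10⁹, Y/10⁹)` as an integer. [folklore] -/
def cornerZ (X Y : ℤ) : ℤ := X * gN + Y * gN - 2 * X * Y

/-- The harmonic range `[Sa, Sb]/10⁹` of the coarse cell `(I, J)` from its four table corners (floor / ceiling). [folklore] -/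
def sRangeZ (I J : ℕ) : ℤ × ℤ :=
  let X0 := XL6 I
  let X1 := XH6 (I + 1)
  let Y0 := XL6 J
  let Y1 := XH6 (J + 1)
  let m := min (min (cornerZ X0 Y0) (cornerZ X0 Y1)) (min (cornerZ X1 Y0) (cornerZ X1 Y1))
  let M := max (max (cornerZ X0 Y0) (cornerZ X0 Y1)) (max (cornerZ X1 Y0) (cornerZ X1 Y1))
  (m / gN, -((-M) / gN))

/-- `cornerZ X Y / 10¹⁸ = tpHarm (X/10⁹) (Y/10⁹)`. [folklore] -/
theorem cornerZ_cast (X Y : ℤ) : ((cornerZ X Y : ℤ) : ℝ) = 1000000000 ^ 2 * tpHarm ((X : ℝ) / 1000000000) ((Y : ℝ) / 1000000000) := by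
  unfold cornerZ tpHarm gN; push_cast; ring

/-- `0 ≤ cornerZ ≤ 10¹⁸` for `X, Y ∈ [0, 10⁹]`. [folklore] -/
theorem cornerZ_mem {X Y : ℤ} (hX0 : 0 ≤ X) (hX1 : X ≤ gN) (hY0 : 0 ≤ Y) (hY1 : Y ≤ gN) :
    0 ≤ cornerZ X Y ∧ cornerZ X Y ≤ gN * gN := by
  unfold cornerZ
  constructor <;> nlinarith [mul_nonneg hX0 (sub_nonneg.2 hY1), mul_nonneg hY0 (sub_nonneg.2 hX1),
    mul_nonneg (sub_nonneg.2 hX1) (sub_nonneg.2 hY1), mul_nonneg hX0 hY0]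

/-- **THE HARMONIC RANGE OF A COARSE CELL**: `0 ≤ Sa`, `Sa/10⁹ ≤ s(k) ≤ Sb/10⁹`, `Sb ≤ 10⁹` for every `k` in the cell. [folklore] -/
theorem sRangeZ_sound {I J : ℕ} (hI : I < 64) (hJ : J < 64) {k : ℝ × ℝ} (hk : k ∈ cellIcc 64 (I, J)) :
    0 ≤ (sRangeZ I J).1 ∧ (((sRangeZ I J).1 : ℤ) : ℝ) / 1000000000 ≤ tpHarm (halfSq k.1) (halfSq k.2) ∧
    tpHarm (halfSq k.1) (halfSq k.2) ≤ (((sRangeZ I J).2 : ℤ) : ℝ) / 1000000000 ∧ (sRangeZ I J).2 ≤ gN := by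
  obtain ⟨⟨h1, h2⟩, ⟨h3, h4⟩⟩ := hk
  obtain ⟨hxl, hxh⟩ := halfSq_mem_of_cell (by norm_num) gridEncl64 (i := I) (by omega) h1 h2
  obtain ⟨hyl, hyh⟩ := halfSq_mem_of_cell (by norm_num) gridEncl64 (i := J) (by omega) h3 h4
  rw [show 6 * (I + 1) = 6 * I + 6 from by ring] at hxh
  rw [show 6 * (J + 1) = 6 * J + 6 from by ring] at hyh
  rw [xl384_cast] at hxl hyl
  rw [xh384_cast] at hxh hyh
  obtain ⟨a0, a1, -, -⟩ := tables_range (i := 6 * I) (by omega)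
  obtain ⟨-, -, b0, b1⟩ := tables_range (i := 6 * I + 6) (by omega)
  obtain ⟨c0, c1, -, -⟩ := tables_range (i := 6 * J) (by omega)
  obtain ⟨-, -, d0, d1⟩ := tables_range (i := 6 * J + 6) (by omega)
  have kmin : ∀ p q : ℝ, min ((1000000000 : ℝ) ^ 2 * p) (1000000000 ^ 2 * q) = 1000000000 ^ 2 * min p q := fun p q => by
    rcases le_total p q with hpq | hpq
    · rw [min_eq_left hpq, min_eq_left (mul_le_mul_of_nonneg_left hpq (by positivity))]
    · rw [min_eq_right hpq, min_eq_right (mul_le_mul_of_nonneg_left hpq (by positivity))]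
  have kmax : ∀ p q : ℝ, max ((1000000000 : ℝ) ^ 2 * p) (1000000000 ^ 2 * q) = 1000000000 ^ 2 * max p q := fun p q => by
    rcases le_total p q with hpq | hpq
    · rw [max_eq_right hpq, max_eq_right (mul_le_mul_of_nonneg_left hpq (by positivity))]
    · rw [max_eq_left hpq, max_eq_left (mul_le_mul_of_nonneg_left hpq (by positivity))]
  have hc := tpHarm_mem_corners hxl hxh hyl hyh
  have hX0 : XL6 I = XL (6 * I) := XL6_eq hI.le
  have hX1 : XH6 (I + 1) = XH (6 * I + 6) := by rw [XH6_eq (by omega : I + 1 ≤ 64), show 6 * (I + 1) = 6 * I + 6 from by ring]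
  have hY0 : XL6 J = XL (6 * J) := XL6_eq hJ.le
  have hY1 : XH6 (J + 1) = XH (6 * J + 6) := by rw [XH6_eq (by omega : J + 1 ≤ 64), show 6 * (J + 1) = 6 * J + 6 from by ring]
  set X0 := XL (6 * I)
  set X1 := XH (6 * I + 6)
  set Y0 := XL (6 * J)
  set Y1 := XH (6 * J + 6)
  have e00 := cornerZ_cast X0 Y0
  have e01 := cornerZ_cast X0 Y1
  have e10 := cornerZ_cast X1 Y0
  have e11 := cornerZ_cast X1 Y1
  obtain ⟨m00, M00⟩ := cornerZ_mem a0 a1 c0 c1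
  obtain ⟨m01, M01⟩ := cornerZ_mem a0 a1 d0 d1
  obtain ⟨m10, M10⟩ := cornerZ_mem b0 b1 c0 c1
  obtain ⟨m11, M11⟩ := cornerZ_mem b0 b1 d0 d1
  have hres : sRangeZ I J = ((min (min (cornerZ X0 Y0) (cornerZ X0 Y1)) (min (cornerZ X1 Y0) (cornerZ X1 Y1))) / gN,
      -((-(max (max (cornerZ X0 Y0) (cornerZ X0 Y1)) (max (cornerZ X1 Y0) (cornerZ X1 Y1)))) / gN)) := by
    unfold sRangeZ; simp only [hX0, hX1, hY0, hY1]
  set mm := min (min (cornerZ X0 Y0) (cornerZ X0 Y1)) (min (cornerZ X1 Y0) (cornerZ X1 Y1)) with hmm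
  set MM := max (max (cornerZ X0 Y0) (cornerZ X0 Y1)) (max (cornerZ X1 Y0) (cornerZ X1 Y1)) with hMM
  have hG : (0 : ℤ) < gN := by simp [gN]
  have hGr : ((gN : ℤ) : ℝ) = 1000000000 := by norm_num [gN]
  rw [hres]
  simp only
  have hmm0 : 0 ≤ mm := by simp only [hmm, le_min_iff]; exact ⟨⟨m00, m01⟩, m10, m11⟩
  have hMM1 : MM ≤ gN * gN := by simp only [hMM, max_le_iff]; exact ⟨⟨M00, M01⟩, M10, M11⟩
  refine ⟨Int.ediv_nonneg hmm0 hG.le, ?_, ?_, ?_⟩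
  · have h1 := int_ediv_cast_le (p := mm) hG
    have hmin : ((mm : ℤ) : ℝ) ≤ 1000000000 ^ 2 * tpHarm (halfSq k.1) (halfSq k.2) := by
      have : ((mm : ℤ) : ℝ) = min (min ((cornerZ X0 Y0 : ℤ) : ℝ) ((cornerZ X0 Y1 : ℤ) : ℝ))
          (min ((cornerZ X1 Y0 : ℤ) : ℝ) ((cornerZ X1 Y1 : ℤ) : ℝ)) := by rw [hmm]; push_cast; rfl
      rw [this, e00, e01, e10, e11, kmin, kmin, kmin]
      exact mul_le_mul_of_nonneg_left hc.1 (by positivity)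
    rw [hGr] at h1
    have : ((mm : ℤ) : ℝ) / 1000000000 / 1000000000 ≤ tpHarm (halfSq k.1) (halfSq k.2) := by
      rw [div_div, div_le_iff₀ (by positivity)]; nlinarith [hmin]
    linarith [div_le_div_of_nonneg_right h1 (by positivity : (0:ℝ) ≤ 1000000000)]
  · have h1 := le_int_neg_ediv_cast (p := MM) hG
    have hmax : 1000000000 ^ 2 * tpHarm (halfSq k.1) (halfSq k.2) ≤ ((MM : ℤ) : ℝ) := by
      have : ((MM : ℤ) : ℝ) = max (max ((cornerZ X0 Y0 : ℤ) : ℝ) ((cornerZ X0 Y1 : ℤ) : ℝ))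
          (max ((cornerZ X1 Y0 : ℤ) : ℝ) ((cornerZ X1 Y1 : ℤ) : ℝ)) := by rw [hMM]; push_cast; rfl
      rw [this, e00, e01, e10, e11, kmax, kmax, kmax]
      exact mul_le_mul_of_nonneg_left hc.2 (by positivity)
    rw [hGr] at h1
    have : tpHarm (halfSq k.1) (halfSq k.2) ≤ ((MM : ℤ) : ℝ) / 1000000000 / 1000000000 := by
      rw [div_div, le_div_iff₀ (by positivity)]; nlinarith [hmax]
    linarith [div_le_div_of_nonneg_right h1 (by positivity : (0:ℝ) ≤ 1000000000)]
  · have : (-MM) / gN ≥ (-(gN * gN)) / gN := Int.ediv_le_ediv hG (by linarith)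
    rw [show -(gN * gN) = gN * (-gN) from by ring, Int.mul_ediv_cancel_left _ hG.ne'] at this
    linarith

/-- Largest shell level `m ≥ 1` (1-based position in the row's OUTER-threshold list) whose threshold is `≤ J`; `0` if none. [folklore] -/
def mloAux : List ℕ → ℕ → ℕ → ℕ → ℕ
  | [], _, _, acc => acc
  | cd :: cs, J, m, acc => mloAux cs J (m + 1) (if cd ≤ J then m else acc)

/-- [folklore] -/
def mloOf (codes : List ℕ) (J : ℕ) : ℕ := mloAux codes J 1 0

/-- First shell level `m ≥ 1` (1-based position in the row's INNER-threshold list) whose threshold is `> J`; `length + 1` if none. [folklore] -/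
def mhiAux : List ℕ → ℕ → ℕ → ℕ
  | [], _, m => m
  | cd :: cs, J, m => if J < cd then m else mhiAux cs J (m + 1)

/-- [folklore] -/
def mhiOf (codes : List ℕ) (J : ℕ) : ℕ := mhiAux codes J 1

/-- Specification of `mloAux`. [folklore] -/
theorem mloAux_spec (cs : List ℕ) (J m acc : ℕ) :
    mloAux cs J m acc = acc ∨ (m ≤ mloAux cs J m acc ∧ mloAux cs J m acc < m + cs.length ∧
      cs.getD (mloAux cs J m acc - m) 0 ≤ J) := by
  induction cs generalizing m acc with
  | nil => left; rfl
  | cons cd cs ih =>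
    simp only [mloAux, List.length_cons]
    set acc' := (if cd ≤ J then m else acc) with hacc'
    rcases ih (m + 1) acc' with h | ⟨h1, h2, h3⟩
    · by_cases hc : cd ≤ J
      · right
        have ha : acc' = m := by rw [hacc', if_pos hc]
        refine ⟨by rw [h, ha], by rw [h, ha]; omega, ?_⟩
        rw [h, ha, Nat.sub_self]; simpa using hc
      · left
        have ha : acc' = acc := by rw [hacc', if_neg hc]
        rw [h, ha]
    · right
      refine ⟨by omega, by omega, ?_⟩
      have e : mloAux cs J (m + 1) acc' - m = (mloAux cs J (m + 1) acc' - (m + 1)) + 1 := by omega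
      rw [e]; simpa using h3

/-- Specification of `mhiAux`. [folklore] -/
theorem mhiAux_spec (cs : List ℕ) (J m : ℕ) :
    m ≤ mhiAux cs J m ∧ mhiAux cs J m ≤ m + cs.length ∧
    (mhiAux cs J m < m + cs.length → J < cs.getD (mhiAux cs J m - m) 0) ∧
    (mhiAux cs J m = m + cs.length → ∀ i, i < cs.length → ¬ J < cs.getD i 0) := by
  induction cs generalizing m with
  | nil => simp [mhiAux]
  | cons cd cs ih =>
    simp only [mhiAux, List.length_cons]
    by_cases hc : J < cd
    · rw [if_pos hc]
      refine ⟨le_rfl, by omega, fun _ => by simpa using hc, fun h => by omega⟩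
    · rw [if_neg hc]
      obtain ⟨h1, h2, h3, h4⟩ := ih (m + 1)
      refine ⟨by omega, by omega, fun hlt => ?_, fun heq i hi => ?_⟩
      · have e : mhiAux cs J (m + 1) - m = (mhiAux cs J (m + 1) - (m + 1)) + 1 := by omega
        rw [e]; simpa using h3 (by omega)
      · rcases i with _ | i
        · simpa using hc
        · simpa using h4 (by omega) i (by simpa using hi)

/-- Specification of `mloOf` (1-based levels). [folklore] -/
theorem mloOf_spec (cs : List ℕ) (J : ℕ) :
    mloOf cs J = 0 ∨ (1 ≤ mloOf cs J ∧ mloOf cs J ≤ cs.length ∧ cs.getD (mloOf cs J - 1) 0 ≤ J) := by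
  unfold mloOf
  rcases mloAux_spec cs J 1 0 with h | ⟨h1, h2, h3⟩
  · left; exact h
  · right; exact ⟨h1, by omega, h3⟩

/-- Specification of `mhiOf` (1-based levels). [folklore] -/
theorem mhiOf_spec (cs : List ℕ) (J : ℕ) :
    1 ≤ mhiOf cs J ∧ mhiOf cs J ≤ cs.length + 1 ∧ (mhiOf cs J ≤ cs.length → J < cs.getD (mhiOf cs J - 1) 0) ∧
    (mhiOf cs J = cs.length + 1 → ∀ i, i < cs.length → ¬ J < cs.getD i 0) := by
  unfold mhiOf
  obtain ⟨h1, h2, h3, h4⟩ := mhiAux_spec cs J 1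
  exact ⟨h1, by omega, fun h => h3 (by omega), fun h => h4 (by omega)⟩

/-- Min-fold of the lower integer weights over a shell segment. [folklore] -/
def foldLo (seg : List ShellZ) (Sa : ℤ) (init : ℤ) : ℤ := seg.foldl (fun acc sh => min acc (wLoZ sh Sa)) init

/-- Max-fold of the upper integer weights over a shell segment. [folklore] -/
def foldHi (seg : List ShellZ) (Sb : ℤ) (init : ℤ) : ℤ := seg.foldl (fun acc sh => max acc (wHiZ sh Sb)) init

/-- The min-fold is below its start and below every member. [folklore] -/
theorem foldLo_le (seg : List ShellZ) (Sa init : ℤ) :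
    foldLo seg Sa init ≤ init ∧ ∀ sh ∈ seg, foldLo seg Sa init ≤ wLoZ sh Sa := by
  induction seg generalizing init with
  | nil => simp [foldLo]
  | cons s0 seg ih =>
    simp only [foldLo, List.foldl_cons, List.mem_cons] at ih ⊢
    obtain ⟨h1, h2⟩ := ih (min init (wLoZ s0 Sa))
    refine ⟨h1.trans (min_le_left _ _), fun sh hsh => ?_⟩
    rcases hsh with rfl | hsh
    · exact h1.trans (min_le_right _ _)
    · exact h2 sh hsh

/-- The max-fold is above its start and above every member. [folklore] -/
theorem le_foldHi (seg : List ShellZ) (Sb init : ℤ) :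
    init ≤ foldHi seg Sb init ∧ ∀ sh ∈ seg, wHiZ sh Sb ≤ foldHi seg Sb init := by
  induction seg generalizing init with
  | nil => simp [foldHi]
  | cons s0 seg ih =>
    simp only [foldHi, List.foldl_cons, List.mem_cons] at ih ⊢
    obtain ⟨h1, h2⟩ := ih (max init (wHiZ s0 Sb))
    refine ⟨(le_max_left _ _).trans h1, fun sh hsh => ?_⟩
    rcases hsh with rfl | hsh
    · exact (le_max_right _ _).trans h1
    · exact h2 sh hsh

/-- LOWER weight of a coarse cell at scale `W`: `min W (max 0 (min_{mlo ≤ m < mhi} wLoZ))`. [folklore] -/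
def cellWlo (shs : List ShellZ) (mlo mhi : ℕ) (Sa : ℤ) : ℤ :=
  min wW (max 0 (foldLo ((shs.drop mlo).take (mhi - mlo)) Sa wW))

/-- UPPER weight of a coarse cell at scale `W`: `max 0 (min W (max_{mlo ≤ m < mhi} wHiZ))`. [folklore] -/
def cellWhi (shs : List ShellZ) (mlo mhi : ℕ) (Sb : ℤ) : ℤ :=
  max 0 (min wW (foldHi ((shs.drop mlo).take (mhi - mlo)) Sb 0))

/-- Segment membership of the `m`-th shell. [folklore] -/
theorem getD_mem_segment (shs : List ShellZ) {mlo mhi m : ℕ} (hlo : mlo ≤ m) (hhi : m < mhi) (hm : m < shs.length) :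
    shs.getD m ⟨0, 0, 0, 0, 0⟩ ∈ (shs.drop mlo).take (mhi - mlo) := by
  rw [List.getD_eq_getElem _ _ hm]
  have e : shs[m] = ((shs.drop mlo).take (mhi - mlo))[m - mlo]'(by simp; omega) := by
    simp [List.getElem_take, List.getElem_drop]; congr 1; omega
  rw [e]; exact List.getElem_mem _

/-- `cellWlo` is below the clipped lower weight of every shell in the segment, and lies in `[0, W]`. [folklore] -/
theorem cellWlo_spec (shs : List ShellZ) {mlo mhi m : ℕ} (hlo : mlo ≤ m) (hhi : m < mhi) (hm : m < shs.length) (Sa : ℤ) :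
    cellWlo shs mlo mhi Sa ≤ max 0 (wLoZ (shs.getD m ⟨0, 0, 0, 0, 0⟩) Sa) := by
  have h := (foldLo_le ((shs.drop mlo).take (mhi - mlo)) Sa wW).2 _ (getD_mem_segment shs hlo hhi hm)
  unfold cellWlo
  exact (min_le_right _ _).trans (max_le_max le_rfl h)

/-- [folklore] -/
theorem cellWlo_mem (shs : List ShellZ) (mlo mhi : ℕ) (Sa : ℤ) : 0 ≤ cellWlo shs mlo mhi Sa ∧ cellWlo shs mlo mhi Sa ≤ wW := by
  unfold cellWlo; exact ⟨le_min (by simp [wW]) (le_max_left _ _), min_le_left _ _⟩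

/-- `cellWhi` is above the clipped upper weight of every shell in the segment. [folklore] -/
theorem cellWhi_spec (shs : List ShellZ) {mlo mhi m : ℕ} (hlo : mlo ≤ m) (hhi : m < mhi) (hm : m < shs.length) (Sb : ℤ) :
    min wW (wHiZ (shs.getD m ⟨0, 0, 0, 0, 0⟩) Sb) ≤ cellWhi shs mlo mhi Sb := by
  have h := (le_foldHi ((shs.drop mlo).take (mhi - mlo)) Sb 0).2 _ (getD_mem_segment shs hlo hhi hm)
  unfold cellWhi
  exact le_trans (min_le_min le_rfl h) (le_max_right _ _)

/-- [folklore] -/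
theorem cellWhi_mem (shs : List ShellZ) (mlo mhi : ℕ) (Sb : ℤ) : 0 ≤ cellWhi shs mlo mhi Sb ∧ cellWhi shs mlo mhi Sb ≤ wW := by
  unfold cellWhi; exact ⟨le_max_left _ _, max_le (by simp [wW]) (min_le_left _ _)⟩

end Summit.Ventures.CertifiedManyBodySolver.Downfold.Emery
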